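import Summits.Ventures.LatticeQCDFlow.Scaling.EntropicTransportSteps

/-!
# LatticeQCDFlow / Scaling — the CALIBRATED transport window laws (file 1 of 2): the items, and STEP 1″ / STEP 2″ with ball volumes below a radius `r₁` only

HONEST FRAMING: exact (Metropolis-corrected) sampling algorithms for lattice gauge theory; figures of merit are
autocorrelation/cost numbers at stated couplings and volumes; no continuum-physics claim.

Venture `LatticeQCDFlow` (cell pub-lqcd), topic `Scaling`, FANOUT row 29 (theory-2) — OUR WORK (THEORY-2.md §3.3
v2.9, rows (C2a-W⁺) / (C2a-H⁺): the PLAQUETTE-CALIBRATED window laws announced as "not typed" in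
`Scaling/ExactTransportBetween.lean`; the laws and instances are in `Scaling/CalibratedWindow.lean`, file 2).
Write `μ_β = μ_{Λ,β}` for the Wilson measure of a continuous `ρ` with `Re tr ρ ≤ N` on the torus `(ℤ/L)^d`,
`S = wilsonAction ρ`, `⟨S⟩_β = wilsonExpectation ρ β S`, `#E = d·L^d`.  This file holds

* the ITEMS `CalibratedCoolingWindow d N G ρ κ C` — for every `L`, every `0 ≤ β₀ ≤ β`, every exact `K`-Lipschitz
  `T_* μ_{β₀} = μ_β` (`K > 0`, sup metric on `G^E`, Mathlib `Measure.map`) and EVERY configuration `U`: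
  `(β - β₀)·(S(U) - ⟨S⟩_{β₀}) ≤ #E·(C + κ·log K)` — and `CalibratedHeatingWindow d N G ρ κ C` (`0 ≤ β ≤ β₀`, exact
  `K'`-co-Lipschitz `T`: `(β₀ - β)·(S(U) - ⟨S⟩_β) ≤ #E·(C + κ·log K')`), plus the hypothesis item
  `SmallBallAsymptotics G κ` (exact small-ball asymptotics of the one-link Haar measure);
* the TOOLS: local product-ball volumes and STEP 1″ / STEP 2″ (`log_partitionFunction_add_le_between_local`,
  `neg_log_partitionFunction_sub_le_between_local`) — the pointwise density-ratio inequalities of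
  `Scaling/ExactTransportBetweenSteps.lean` (STEP 1′) and `Scaling/EntropicTransportSteps.lean` (STEP 2′) with the
  two-sided ball volumes `a·r^κ ≤ Haar(B̄(g,r)) ≤ A·r^κ` assumed for `0 < r ≤ r₁` ONLY (`r₁ > 0` arbitrary: the
  comparison radius is also kept below `r₁` and `r₁/K`), which is what lets the constant `log(A/a)` be taken from the
  ASYMPTOTIC ball-volume ratio (`→ 0` under `SmallBallAsymptotics`) rather than from global constants.

Elementary given the tree; nothing here is cited as a fact.  Reading: Cover–Thomas, *Elements of Information Theory*
2nd ed., Thm 8.6.4 (`h(AX) = h(X) + log|det A|`); Villani, *Topics in Optimal Transportation* (2003) §6.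
-/

noncomputable section

namespace Summit.Ventures.LatticeQCDFlow.Theory2.Lattice

open MeasureTheory Metric Set Literature.MathematicalPhysics.QuantumFieldTheory

/-! ## §0. The items -/

section Defs

variable (d N : ℕ) (G : Type) [Group G] [MetricSpace G] [IsTopologicalGroup G] [CompactSpace G]
  [MeasurableSpace G] [BorelSpace G] (ρ : G →* Matrix (Fin N) (Fin N) ℂ) (κ : ℕ) (C : ℝ)

/-- **(C2a-W⁺) CALIBRATED COOLING WINDOW LAW with per-link constant `C`** (OURS, THEORY-2.md §3.3 v2.9): for every
volume `L`, every `0 ≤ β₀ ≤ β`, every exact `K`-Lipschitz transport `T` of `μ_{Λ,β₀}` onto `μ_{Λ,β}` (`K > 0`, sup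
metric on `G^E`) and EVERY configuration `U`: `(β - β₀)·(S(U) - ⟨S⟩_{Λ,β₀}) ≤ #E·(C + κ·log K)`.  Proved with
`C = log(A/a)` from local two-sided ball volumes, and with `C = 0` from exact small-ball asymptotics. [folklore] -/
@[conjecture]
def CalibratedCoolingWindow : Prop :=
  ∀ (L : ℕ) [NeZero L] (β₀ β : ℝ), 0 ≤ β₀ → β₀ ≤ β →
    ∀ (T : GaugeConfig d L G → GaugeConfig d L G) (K : NNReal), 0 < (K : ℝ) → LipschitzWith K T →
      (wilsonMeasure (d := d) (L := L) ρ β₀).map T = wilsonMeasure (d := d) (L := L) ρ β →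
      ∀ U : GaugeConfig d L G,
        (β - β₀) * (wilsonAction ρ U - wilsonExpectation (d := d) (L := L) ρ β₀ (wilsonAction (d := d) (L := L) ρ)) ≤
          Fintype.card (Edge d L) * (C + κ * Real.log (K : ℝ))

/-- **(C2a-H⁺) CALIBRATED HEATING WINDOW LAW with per-link constant `C`** (OURS, THEORY-2.md §3.3 v2.9): for every
volume `L`, every `0 ≤ β ≤ β₀`, every exact `K'`-co-Lipschitz transport `T` of `μ_{Λ,β₀}` onto `μ_{Λ,β}` (`K' > 0`:
`dist x y ≤ K'·dist (Tx) (Ty)`) and EVERY configuration `U`: `(β₀ - β)·(S(U) - ⟨S⟩_{Λ,β}) ≤ #E·(C + κ·log K')`.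
[folklore] -/
@[conjecture]
def CalibratedHeatingWindow : Prop :=
  ∀ (L : ℕ) [NeZero L] (β β₀ : ℝ), 0 ≤ β → β ≤ β₀ →
    ∀ (T : GaugeConfig d L G → GaugeConfig d L G) (K' : NNReal), 0 < (K' : ℝ) → AntilipschitzWith K' T →
      (wilsonMeasure (d := d) (L := L) ρ β₀).map T = wilsonMeasure (d := d) (L := L) ρ β →
      ∀ U : GaugeConfig d L G,
        (β₀ - β) * (wilsonAction ρ U - wilsonExpectation (d := d) (L := L) ρ β (wilsonAction (d := d) (L := L) ρ)) ≤
          Fintype.card (Edge d L) * (C + κ * Real.log (K' : ℝ))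

end Defs

section DefsGroup

variable (G : Type) [Group G] [MetricSpace G] [IsTopologicalGroup G] [CompactSpace G]
  [MeasurableSpace G] [BorelSpace G] (κ : ℕ)

/-- **Exact small-ball asymptotics with exponent `κ`** for the Haar probability measure of a compact metric group:
for every `ε > 0` there are a radius `r₁ > 0` and constants `0 < a`, `A ≤ (1 + ε)·a` with
`a·r^κ ≤ Haar(B̄(g, r)) ≤ A·r^κ` for all `g` and all `0 < r ≤ r₁` (i.e. `Haar(B̄(g,r))/r^κ` converges, uniformly in
`g`, to a positive limit).  A HYPOTHESIS ITEM: true for every compact Lie group with a bi-invariant Riemannian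
(or chordal) distance, `κ = dim G` (Gray's tube/ball-volume expansion); for `U(1)` with the chordal metric it is
`Haar(B̄(g,r)) = (2/π)·arcsin(r/2)` (THEORY-2.md §3.3 v2.9, discharged separately); not proved in this file.
[folklore] -/
@[conjecture]
def SmallBallAsymptotics : Prop :=
  ∀ ε : ℝ, 0 < ε → ∃ r₁ a A : ℝ, 0 < r₁ ∧ 0 < a ∧ A ≤ (1 + ε) * a ∧
    ∀ (g : G) (r : ℝ), 0 < r → r ≤ r₁ →
      a * r ^ κ ≤ (haarProbability G (closedBall g r)).toReal ∧
        (haarProbability G (closedBall g r)).toReal ≤ A * r ^ κ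

end DefsGroup

/-! ## §1. Tools: local product-ball volumes; STEP 1″ and STEP 2″ with ball volumes below a radius `r₁` only -/

section Tools

variable {N : ℕ} {G : Type} [Group G] [MetricSpace G] [IsTopologicalGroup G] [CompactSpace G]
  [SecondCountableTopology G] [MeasurableSpace G] [BorelSpace G]
  (ρ : G →* Matrix (Fin N) (Fin N) ℂ)

omit [SecondCountableTopology G] in
/-- Lower volume of a configuration ball from a LOCAL one-link lower bound (`r ≤ r₁`). [folklore] -/
theorem pow_le_pi_closedBall_local {d L : ℕ} {κ : ℕ} {a r₁ : ℝ} (ha : 0 ≤ a)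
    (hlo : ∀ (g : G) (r : ℝ), 0 < r → r ≤ r₁ → a * r ^ κ ≤ (haarProbability G (closedBall g r)).toReal)
    [NeZero L] (U : GaugeConfig d L G) {r : ℝ} (hr : 0 < r) (hr1 : r ≤ r₁) :
    (a * r ^ κ) ^ Fintype.card (Edge d L) ≤
      ((Measure.pi fun _ : Edge d L => haarProbability G) (closedBall U r)).toReal := by
  rw [pi_closedBall_eq U hr.le, ENNReal.toReal_prod, ← Finset.card_univ, ← Finset.prod_const]
  exact Finset.prod_le_prod (fun _ _ => by positivity) fun e _ => hlo (U e) r hr hr1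

omit [SecondCountableTopology G] in
/-- Upper volume of a configuration ball from a LOCAL one-link upper bound (`r ≤ r₁`). [folklore] -/
theorem pi_closedBall_le_pow_local {d L : ℕ} {κ : ℕ} {A r₁ : ℝ}
    (hup : ∀ (g : G) (r : ℝ), 0 < r → r ≤ r₁ → (haarProbability G (closedBall g r)).toReal ≤ A * r ^ κ)
    [NeZero L] (U : GaugeConfig d L G) {r : ℝ} (hr : 0 < r) (hr1 : r ≤ r₁) :
    ((Measure.pi fun _ : Edge d L => haarProbability G) (closedBall U r)).toReal ≤
      (A * r ^ κ) ^ Fintype.card (Edge d L) := by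
  rw [pi_closedBall_eq U hr.le, ENNReal.toReal_prod, ← Finset.card_univ, ← Finset.prod_const]
  exact Finset.prod_le_prod (fun _ _ => ENNReal.toReal_nonneg) fun e _ => hup (U e) r hr hr1

omit [SecondCountableTopology G] in
/-- **STEP 1″ — the density-ratio step between couplings, LOCAL ball volumes**: for an exact `K`-Lipschitz transport
`T` of `μ_{Λ,β₀}` onto `μ_{Λ,β}` (`K > 0`, `β₀, β ≥ 0`) and two-sided ball volumes below a radius `r₁ > 0`,
`log Z_Λ(β) - log Z_Λ(β₀) + β·S(Tx) - β₀·S(x) ≤ #E·(log(A/a) + κ·log K)` at every `x` (compare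
`μ_{β₀}(B̄(x,r)) ≤ μ_β(B̄(Tx,Kr))` as `r → 0`; the tree's STEP 1′ with the comparison radius also kept below `r₁`
and `r₁/K`). [folklore] -/
theorem log_partitionFunction_add_le_between_local {d L : ℕ} [NeZero L]
    (hρ : Continuous (ρ : G → Matrix (Fin N) (Fin N) ℂ)) (htr : ∀ g, (ρ g).trace.re ≤ N)
    {κ : ℕ} {a A r₁ : ℝ} (ha : 0 < a) (hA : 0 < A) (hr₁ : 0 < r₁)
    (hlo : ∀ (g : G) (r : ℝ), 0 < r → r ≤ r₁ → a * r ^ κ ≤ (haarProbability G (closedBall g r)).toReal)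
    (hup : ∀ (g : G) (r : ℝ), 0 < r → r ≤ r₁ → (haarProbability G (closedBall g r)).toReal ≤ A * r ^ κ)
    {β₀ β : ℝ} (hβ₀ : 0 ≤ β₀) (hβ0 : 0 ≤ β) {T : GaugeConfig d L G → GaugeConfig d L G} {K : NNReal}
    (hK0 : 0 < (K : ℝ)) (hT : LipschitzWith K T)
    (hmap : (wilsonMeasure (d := d) (L := L) ρ β₀).map T = wilsonMeasure (d := d) (L := L) ρ β)
    (x : GaugeConfig d L G) :
    Real.log (partitionFunction (d := d) (L := L) ρ β).toReal -
        Real.log (partitionFunction (d := d) (L := L) ρ β₀).toReal +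
        β * wilsonAction ρ (T x) - β₀ * wilsonAction ρ x ≤
      Fintype.card (Edge d L) * (Real.log (A / a) + κ * Real.log K) := by
  set π : Measure (GaugeConfig d L G) := Measure.pi fun _ : Edge d L => haarProbability G with hπ
  set S : GaugeConfig d L G → ℝ := wilsonAction (d := d) (L := L) ρ with hSdef
  have hScont : Continuous S := continuous_wilsonAction (d := d) (L := L) ρ hρ
  have hTm : Measurable T := hT.continuous.measurable
  set nE : ℕ := Fintype.card (Edge d L) with hnE
  have hZ0 : partitionFunction (d := d) (L := L) ρ β ≠ 0 := partitionFunction_ne_zero ρ hρ β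
  have hZtop : partitionFunction (d := d) (L := L) ρ β ≠ ⊤ :=
    ne_top_of_le_ne_top ENNReal.one_ne_top (partitionFunction_le_one ρ htr hβ0)
  set Z : ℝ := (partitionFunction (d := d) (L := L) ρ β).toReal with hZdef
  have hZpos : 0 < Z := ENNReal.toReal_pos hZ0 hZtop
  have hZ₀0 : partitionFunction (d := d) (L := L) ρ β₀ ≠ 0 := partitionFunction_ne_zero ρ hρ β₀
  have hZ₀top : partitionFunction (d := d) (L := L) ρ β₀ ≠ ⊤ :=
    ne_top_of_le_ne_top ENNReal.one_ne_top (partitionFunction_le_one ρ htr hβ₀)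
  set Z₀ : ℝ := (partitionFunction (d := d) (L := L) ρ β₀).toReal with hZ₀def
  have hZ₀pos : 0 < Z₀ := ENNReal.toReal_pos hZ₀0 hZ₀top
  have hμT : ∀ B : Set (GaugeConfig d L G), MeasurableSet B →
      wilsonMeasure (d := d) (L := L) ρ β B = wilsonMeasure (d := d) (L := L) ρ β₀ (T ⁻¹' B) := fun B hB => by
    rw [← hmap, Measure.map_apply hTm hB]
  have hμW : ∀ (β' : ℝ) (B : Set (GaugeConfig d L G)),
      wilsonMeasure (d := d) (L := L) ρ β' B = (partitionFunction ρ β')⁻¹ * wilsonWeight ρ β' B := fun β' B => by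
    show ((partitionFunction ρ β')⁻¹ • wilsonWeight ρ β') B = _
    rw [Measure.smul_apply, smul_eq_mul]
  have hK1 : (1 : ℝ) ≤ K + 1 := by linarith [K.coe_nonneg]
  refine le_of_forall_pos_le_add fun ε hε => ?_
  have hε' : 0 < ε / (β + β₀ + 1) := by positivity
  have hβε : (β + β₀) * (ε / (β + β₀ + 1)) ≤ ε := by
    rw [mul_div_assoc', div_le_iff₀ (by positivity)]; nlinarith
  obtain ⟨δ₁, hδ₁, hδ₁S⟩ := Metric.continuous_iff.1 hScont (T x) (ε / (β + β₀ + 1)) hε'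
  obtain ⟨δ₀, hδ₀, hδ₀S⟩ := Metric.continuous_iff.1 hScont x (ε / (β + β₀ + 1)) hε'
  set r : ℝ := min (min (r₁ / (K + 1)) (δ₀ / 2)) (δ₁ / (2 * K)) with hr
  have hr0 : 0 < r := lt_min (lt_min (by positivity) (by positivity)) (by positivity)
  have hrK1 : r ≤ r₁ / (K + 1) := (min_le_left _ _).trans (min_le_left _ _)
  have hr1 : r ≤ r₁ := hrK1.trans (div_le_self hr₁.le hK1)
  have hKr1 : K * r ≤ r₁ := by
    calc (K : ℝ) * r ≤ K * (r₁ / (K + 1)) := mul_le_mul_of_nonneg_left hrK1 hK0.le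
      _ = r₁ * (K / (K + 1)) := by ring
      _ ≤ r₁ * 1 := mul_le_mul_of_nonneg_left ((div_le_one (by positivity)).2 (by linarith)) hr₁.le
      _ = r₁ := mul_one _
  have hrδ₀ : r < δ₀ := lt_of_le_of_lt ((min_le_left _ _).trans (min_le_right _ _)) (by linarith)
  have hKr : K * r < δ₁ := by
    have : r ≤ δ₁ / (2 * K) := min_le_right _ _
    calc (K : ℝ) * r ≤ K * (δ₁ / (2 * K)) := mul_le_mul_of_nonneg_left this hK0.le
      _ = δ₁ / 2 := by field_simp
      _ < δ₁ := by linarith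
  -- (i) `Z₀⁻¹ e^{-β₀(S x + ε')} (a r^κ)^{nE} ≤ μ₀(B̄(x, r))`
  have h1 := pow_le_pi_closedBall_local ha.le hlo x hr0 hr1
  have hSB₀ : ∀ U ∈ closedBall x r, S U ≤ S x + ε / (β + β₀ + 1) := fun U hU => by
    have hd : dist U x < δ₀ := lt_of_le_of_lt (mem_closedBall.1 hU) hrδ₀
    have := hδ₀S U hd
    rw [Real.dist_eq] at this
    linarith [(abs_lt.1 this).2]
  have h3₀ := le_wilsonWeight_of_le ρ hβ₀ measurableSet_closedBall hSB₀
  -- (ii) `μ₀(B̄(x,r)) ≤ μ(B̄(Tx, K r))`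
  have hsub : closedBall x r ⊆ T ⁻¹' closedBall (T x) (K * r) := fun u hu => by
    rw [mem_preimage, mem_closedBall]
    exact (hT.dist_le_mul u x).trans (mul_le_mul_of_nonneg_left (mem_closedBall.1 hu) K.coe_nonneg)
  have h2 : wilsonMeasure (d := d) (L := L) ρ β₀ (closedBall x r) ≤
      wilsonMeasure (d := d) (L := L) ρ β (closedBall (T x) (K * r)) := by
    rw [hμT _ measurableSet_closedBall]; exact measure_mono hsub
  -- (iii) `μ(B̄(Tx, Kr)) ≤ Z⁻¹ e^{-β(S(Tx) - ε')} (A (Kr)^κ)^{nE}`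
  have hSB : ∀ U ∈ closedBall (T x) (K * r), S (T x) - ε / (β + β₀ + 1) ≤ S U := fun U hU => by
    have hd : dist U (T x) < δ₁ := lt_of_le_of_lt (mem_closedBall.1 hU) hKr
    have := hδ₁S U hd
    rw [Real.dist_eq] at this
    linarith [(abs_lt.1 this).1]
  have h3 := wilsonWeight_le_of_le ρ hβ0 measurableSet_closedBall hSB
  have h4 := pi_closedBall_le_pow_local hup (T x) (mul_pos hK0 hr0) hKr1
  have hfin : (partitionFunction (d := d) (L := L) ρ β)⁻¹ *
      (ENNReal.ofReal (Real.exp (-(β * (S (T x) - ε / (β + β₀ + 1))))) * π (closedBall (T x) (K * r))) ≠ ⊤ :=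
    ENNReal.mul_ne_top (ENNReal.inv_ne_top.2 hZ0) (ENNReal.mul_ne_top ENNReal.ofReal_ne_top (measure_ne_top _ _))
  have h5 : (partitionFunction (d := d) (L := L) ρ β₀)⁻¹ *
        (ENNReal.ofReal (Real.exp (-(β₀ * (S x + ε / (β + β₀ + 1))))) * π (closedBall x r)) ≤
      (partitionFunction (d := d) (L := L) ρ β)⁻¹ *
        (ENNReal.ofReal (Real.exp (-(β * (S (T x) - ε / (β + β₀ + 1))))) * π (closedBall (T x) (K * r))) :=
    calc _ ≤ wilsonMeasure (d := d) (L := L) ρ β₀ (closedBall x r) := by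
          rw [hμW]; exact mul_le_mul' le_rfl h3₀
      _ ≤ wilsonMeasure (d := d) (L := L) ρ β (closedBall (T x) (K * r)) := h2
      _ ≤ _ := by rw [hμW]; exact mul_le_mul' le_rfl h3
  have h6 := ENNReal.toReal_mono hfin h5
  rw [ENNReal.toReal_mul, ENNReal.toReal_mul, ENNReal.toReal_mul, ENNReal.toReal_mul, ENNReal.toReal_inv,
    ENNReal.toReal_inv, ENNReal.toReal_ofReal (Real.exp_pos _).le, ENNReal.toReal_ofReal (Real.exp_pos _).le]
    at h6
  have h7 : Z₀⁻¹ * (Real.exp (-(β₀ * (S x + ε / (β + β₀ + 1)))) * (a * r ^ κ) ^ nE) ≤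
      Z⁻¹ * (Real.exp (-(β * (S (T x) - ε / (β + β₀ + 1)))) * (A * (K * r) ^ κ) ^ nE) :=
    calc Z₀⁻¹ * (Real.exp (-(β₀ * (S x + ε / (β + β₀ + 1)))) * (a * r ^ κ) ^ nE)
        ≤ Z₀⁻¹ * (Real.exp (-(β₀ * (S x + ε / (β + β₀ + 1)))) * (π (closedBall x r)).toReal) :=
          mul_le_mul_of_nonneg_left (mul_le_mul_of_nonneg_left h1 (Real.exp_pos _).le)
            (inv_nonneg.2 hZ₀pos.le)
      _ ≤ Z⁻¹ * (Real.exp (-(β * (S (T x) - ε / (β + β₀ + 1)))) * (π (closedBall (T x) (K * r))).toReal) := h6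
      _ ≤ Z⁻¹ * (Real.exp (-(β * (S (T x) - ε / (β + β₀ + 1)))) * (A * (K * r) ^ κ) ^ nE) :=
          mul_le_mul_of_nonneg_left (mul_le_mul_of_nonneg_left h4 (Real.exp_pos _).le)
            (inv_nonneg.2 hZpos.le)
  have hlhs : 0 < Z₀⁻¹ * (Real.exp (-(β₀ * (S x + ε / (β + β₀ + 1)))) * (a * r ^ κ) ^ nE) := by positivity
  have h8 := Real.log_le_log hlhs h7
  rw [Real.log_mul (inv_pos.2 hZ₀pos).ne' (by positivity), Real.log_inv,
    Real.log_mul (Real.exp_pos _).ne' (by positivity), Real.log_exp, Real.log_pow,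
    Real.log_mul ha.ne' (pow_pos hr0 _).ne', Real.log_pow,
    Real.log_mul (inv_pos.2 hZpos).ne' (by positivity), Real.log_inv,
    Real.log_mul (Real.exp_pos _).ne' (by positivity), Real.log_exp, Real.log_pow,
    Real.log_mul hA.ne' (by positivity), Real.log_pow, Real.log_mul hK0.ne' hr0.ne'] at h8
  rw [Real.log_div hA.ne' ha.ne']
  linarith only [h8, hβε]

omit [SecondCountableTopology G] in
/-- **STEP 2″ — the co-Lipschitz density-ratio step between couplings, LOCAL ball volumes**: for an exact
`K'`-co-Lipschitz transport `T` of `μ_{Λ,β₀}` onto `μ_{Λ,β}` (`K' > 0`, `β₀, β ≥ 0`; measurability from exactness)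
and two-sided ball volumes below a radius `r₁ > 0`,
`log Z_Λ(β₀) - log Z_Λ(β) + β₀·S(x) - β·S(Tx) ≤ #E·(log(A/a) + κ·log K')` at every `x`. [folklore] -/
theorem neg_log_partitionFunction_sub_le_between_local {d L : ℕ} [NeZero L]
    (hρ : Continuous (ρ : G → Matrix (Fin N) (Fin N) ℂ)) (htr : ∀ g, (ρ g).trace.re ≤ N)
    {κ : ℕ} {a A r₁ : ℝ} (ha : 0 < a) (hA : 0 < A) (hr₁ : 0 < r₁)
    (hlo : ∀ (g : G) (r : ℝ), 0 < r → r ≤ r₁ → a * r ^ κ ≤ (haarProbability G (closedBall g r)).toReal)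
    (hup : ∀ (g : G) (r : ℝ), 0 < r → r ≤ r₁ → (haarProbability G (closedBall g r)).toReal ≤ A * r ^ κ)
    {β₀ β : ℝ} (hβ₀ : 0 ≤ β₀) (hβ0 : 0 ≤ β) {T : GaugeConfig d L G → GaugeConfig d L G} {K' : NNReal}
    (hK'0 : 0 < (K' : ℝ)) (hT' : AntilipschitzWith K' T)
    (hmap : (wilsonMeasure (d := d) (L := L) ρ β₀).map T = wilsonMeasure (d := d) (L := L) ρ β)
    (x : GaugeConfig d L G) :
    Real.log (partitionFunction (d := d) (L := L) ρ β₀).toReal -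
        Real.log (partitionFunction (d := d) (L := L) ρ β).toReal +
        β₀ * wilsonAction ρ x - β * wilsonAction ρ (T x) ≤
      Fintype.card (Edge d L) * (Real.log (A / a) + κ * Real.log K') := by
  set π : Measure (GaugeConfig d L G) := Measure.pi fun _ : Edge d L => haarProbability G with hπ
  set S : GaugeConfig d L G → ℝ := wilsonAction (d := d) (L := L) ρ with hSdef
  have hScont : Continuous S := continuous_wilsonAction (d := d) (L := L) ρ hρ
  have hTm : AEMeasurable T (wilsonMeasure (d := d) (L := L) ρ β₀) :=
    aemeasurable_of_map_eq_between ρ hρ htr hβ0 hmap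
  set nE : ℕ := Fintype.card (Edge d L) with hnE
  have hZ0 : partitionFunction (d := d) (L := L) ρ β ≠ 0 := partitionFunction_ne_zero ρ hρ β
  have hZtop : partitionFunction (d := d) (L := L) ρ β ≠ ⊤ :=
    ne_top_of_le_ne_top ENNReal.one_ne_top (partitionFunction_le_one ρ htr hβ0)
  set Z : ℝ := (partitionFunction (d := d) (L := L) ρ β).toReal with hZdef
  have hZpos : 0 < Z := ENNReal.toReal_pos hZ0 hZtop
  have hZ₀0 : partitionFunction (d := d) (L := L) ρ β₀ ≠ 0 := partitionFunction_ne_zero ρ hρ β₀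
  have hZ₀top : partitionFunction (d := d) (L := L) ρ β₀ ≠ ⊤ :=
    ne_top_of_le_ne_top ENNReal.one_ne_top (partitionFunction_le_one ρ htr hβ₀)
  set Z₀ : ℝ := (partitionFunction (d := d) (L := L) ρ β₀).toReal with hZ₀def
  have hZ₀pos : 0 < Z₀ := ENNReal.toReal_pos hZ₀0 hZ₀top
  have hμT : ∀ B : Set (GaugeConfig d L G), MeasurableSet B →
      wilsonMeasure (d := d) (L := L) ρ β B = wilsonMeasure (d := d) (L := L) ρ β₀ (T ⁻¹' B) := fun B hB => by
    rw [← hmap, Measure.map_apply_of_aemeasurable hTm hB]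
  have hμW : ∀ (β' : ℝ) (B : Set (GaugeConfig d L G)),
      wilsonMeasure (d := d) (L := L) ρ β' B = (partitionFunction ρ β')⁻¹ * wilsonWeight ρ β' B := fun β' B => by
    show ((partitionFunction ρ β')⁻¹ • wilsonWeight ρ β') B = _
    rw [Measure.smul_apply, smul_eq_mul]
  have hK1 : (1 : ℝ) ≤ K' + 1 := by linarith [K'.coe_nonneg]
  refine le_of_forall_pos_le_add fun ε hε => ?_
  have hε' : 0 < ε / (β + β₀ + 1) := by positivity
  have hβε : (β + β₀) * (ε / (β + β₀ + 1)) ≤ ε := by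
    rw [mul_div_assoc', div_le_iff₀ (by positivity)]; nlinarith
  obtain ⟨δ₁, hδ₁, hδ₁S⟩ := Metric.continuous_iff.1 hScont (T x) (ε / (β + β₀ + 1)) hε'
  obtain ⟨δ₀, hδ₀, hδ₀S⟩ := Metric.continuous_iff.1 hScont x (ε / (β + β₀ + 1)) hε'
  set r : ℝ := min (min (r₁ / (K' + 1)) (δ₁ / 2)) (δ₀ / (2 * K')) with hr
  have hr0 : 0 < r := lt_min (lt_min (by positivity) (by positivity)) (by positivity)
  have hrK1 : r ≤ r₁ / (K' + 1) := (min_le_left _ _).trans (min_le_left _ _)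
  have hr1 : r ≤ r₁ := hrK1.trans (div_le_self hr₁.le hK1)
  have hK'r1 : K' * r ≤ r₁ := by
    calc (K' : ℝ) * r ≤ K' * (r₁ / (K' + 1)) := mul_le_mul_of_nonneg_left hrK1 hK'0.le
      _ = r₁ * (K' / (K' + 1)) := by ring
      _ ≤ r₁ * 1 := mul_le_mul_of_nonneg_left ((div_le_one (by positivity)).2 (by linarith)) hr₁.le
      _ = r₁ := mul_one _
  have hrδ₁ : r < δ₁ := lt_of_le_of_lt ((min_le_left _ _).trans (min_le_right _ _)) (by linarith)
  have hK'r : K' * r < δ₀ := by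
    have : r ≤ δ₀ / (2 * K') := min_le_right _ _
    calc (K' : ℝ) * r ≤ K' * (δ₀ / (2 * K')) := mul_le_mul_of_nonneg_left this hK'0.le
      _ = δ₀ / 2 := by field_simp
      _ < δ₀ := by linarith
  -- (i) `Z⁻¹ e^{-β(S(Tx) + ε')} (a r^κ)^{nE} ≤ μ(B̄(Tx, r))`
  have h1 := pow_le_pi_closedBall_local ha.le hlo (T x) hr0 hr1
  have hSB : ∀ U ∈ closedBall (T x) r, S U ≤ S (T x) + ε / (β + β₀ + 1) := fun U hU => by
    have hd : dist U (T x) < δ₁ := lt_of_le_of_lt (mem_closedBall.1 hU) hrδ₁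
    have := hδ₁S U hd
    rw [Real.dist_eq] at this
    linarith [(abs_lt.1 this).2]
  have h3 := le_wilsonWeight_of_le ρ hβ0 measurableSet_closedBall hSB
  -- (ii) `μ(B̄(Tx, r)) = μ₀(T⁻¹ B̄(Tx, r)) ≤ μ₀(B̄(x, K' r))`
  have hsub : T ⁻¹' closedBall (T x) r ⊆ closedBall x (K' * r) := fun u hu => by
    rw [mem_preimage, mem_closedBall] at hu
    rw [mem_closedBall]
    exact (hT'.le_mul_dist u x).trans (mul_le_mul_of_nonneg_left hu K'.coe_nonneg)
  have h2 : wilsonMeasure (d := d) (L := L) ρ β (closedBall (T x) r) ≤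
      wilsonMeasure (d := d) (L := L) ρ β₀ (closedBall x (K' * r)) := by
    rw [hμT _ measurableSet_closedBall]; exact measure_mono hsub
  -- (iii) `μ₀(B̄(x, K' r)) ≤ Z₀⁻¹ e^{-β₀(S x - ε')} (A (K' r)^κ)^{nE}`
  have hSB₀ : ∀ U ∈ closedBall x (K' * r), S x - ε / (β + β₀ + 1) ≤ S U := fun U hU => by
    have hd : dist U x < δ₀ := lt_of_le_of_lt (mem_closedBall.1 hU) hK'r
    have := hδ₀S U hd
    rw [Real.dist_eq] at this
    linarith [(abs_lt.1 this).1]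
  have h3₀ := wilsonWeight_le_of_le ρ hβ₀ measurableSet_closedBall hSB₀
  have h4 := pi_closedBall_le_pow_local hup x (mul_pos hK'0 hr0) hK'r1
  have hfin : (partitionFunction (d := d) (L := L) ρ β₀)⁻¹ *
      (ENNReal.ofReal (Real.exp (-(β₀ * (S x - ε / (β + β₀ + 1))))) * π (closedBall x (K' * r))) ≠ ⊤ :=
    ENNReal.mul_ne_top (ENNReal.inv_ne_top.2 hZ₀0) (ENNReal.mul_ne_top ENNReal.ofReal_ne_top (measure_ne_top _ _))
  have h5 : (partitionFunction (d := d) (L := L) ρ β)⁻¹ *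
        (ENNReal.ofReal (Real.exp (-(β * (S (T x) + ε / (β + β₀ + 1))))) * π (closedBall (T x) r)) ≤
      (partitionFunction (d := d) (L := L) ρ β₀)⁻¹ *
        (ENNReal.ofReal (Real.exp (-(β₀ * (S x - ε / (β + β₀ + 1))))) * π (closedBall x (K' * r))) :=
    calc _ ≤ wilsonMeasure (d := d) (L := L) ρ β (closedBall (T x) r) := by
          rw [hμW]; exact mul_le_mul' le_rfl h3
      _ ≤ wilsonMeasure (d := d) (L := L) ρ β₀ (closedBall x (K' * r)) := h2
      _ ≤ _ := by rw [hμW]; exact mul_le_mul' le_rfl h3₀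
  have h6 := ENNReal.toReal_mono hfin h5
  rw [ENNReal.toReal_mul, ENNReal.toReal_mul, ENNReal.toReal_mul, ENNReal.toReal_mul, ENNReal.toReal_inv,
    ENNReal.toReal_inv, ENNReal.toReal_ofReal (Real.exp_pos _).le, ENNReal.toReal_ofReal (Real.exp_pos _).le]
    at h6
  have h7 : Z⁻¹ * (Real.exp (-(β * (S (T x) + ε / (β + β₀ + 1)))) * (a * r ^ κ) ^ nE) ≤
      Z₀⁻¹ * (Real.exp (-(β₀ * (S x - ε / (β + β₀ + 1)))) * (A * (K' * r) ^ κ) ^ nE) :=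
    calc Z⁻¹ * (Real.exp (-(β * (S (T x) + ε / (β + β₀ + 1)))) * (a * r ^ κ) ^ nE)
        ≤ Z⁻¹ * (Real.exp (-(β * (S (T x) + ε / (β + β₀ + 1)))) * (π (closedBall (T x) r)).toReal) :=
          mul_le_mul_of_nonneg_left (mul_le_mul_of_nonneg_left h1 (Real.exp_pos _).le)
            (inv_nonneg.2 hZpos.le)
      _ ≤ Z₀⁻¹ * (Real.exp (-(β₀ * (S x - ε / (β + β₀ + 1)))) * (π (closedBall x (K' * r))).toReal) := h6
      _ ≤ Z₀⁻¹ * (Real.exp (-(β₀ * (S x - ε / (β + β₀ + 1)))) * (A * (K' * r) ^ κ) ^ nE) :=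
          mul_le_mul_of_nonneg_left (mul_le_mul_of_nonneg_left h4 (Real.exp_pos _).le)
            (inv_nonneg.2 hZ₀pos.le)
  have hlhs : 0 < Z⁻¹ * (Real.exp (-(β * (S (T x) + ε / (β + β₀ + 1)))) * (a * r ^ κ) ^ nE) := by positivity
  have h8 := Real.log_le_log hlhs h7
  rw [Real.log_mul (inv_pos.2 hZpos).ne' (by positivity), Real.log_inv,
    Real.log_mul (Real.exp_pos _).ne' (by positivity), Real.log_exp, Real.log_pow,
    Real.log_mul ha.ne' (pow_pos hr0 _).ne', Real.log_pow,
    Real.log_mul (inv_pos.2 hZ₀pos).ne' (by positivity), Real.log_inv,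
    Real.log_mul (Real.exp_pos _).ne' (by positivity), Real.log_exp, Real.log_pow,
    Real.log_mul hA.ne' (by positivity), Real.log_pow, Real.log_mul hK'0.ne' hr0.ne'] at h8
  rw [Real.log_div hA.ne' ha.ne']
  linarith only [h8, hβε]

end Tools

end Summit.Ventures.LatticeQCDFlow.Theory2.Lattice
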